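import Literature.MathematicalPhysics.QuantumFieldTheory.Balaban1983to89.B4Eq220CubeField

/-!
# `Balaban1983to89.B4Eq221PsupCubeField` — [Balaban1983RegularityDecay] (2.21), THE FIRST GRADED FACTOR
# «‖K_{ω₁}G_k(□_{ω₁},Ã_{ω₁})h_{ω₁}‖_{∞,p₁}» (the edge `q = ∞`, `p ≥ p₁` of «(2.17) with 1/p − 1/q = 1/p₁») AT THE CUBE
# CONFIGURATION `Ã_j = A₀ + θ_jA′` OF A (1.7)-REGULAR FIELD, `η`-UNIFORMLY, with only «e sufficiently small»

statement-level skeleton of published theorems with citation tags; proofs where landed; nothing here is a claim about the Yang–Mills mass gap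

CITATION HEADER.  T. Bałaban, *Regularity and decay of lattice Green's functions*, Commun. Math. Phys. **89** (1983)
571–597, doi:10.1007/bf01214744 [Balaban1983RegularityDecay] (cell paper B4; held text
`paper:balaban1983-cmp89-regularity-decay`, journal page = PDF page + 570; pp. 572–573, 575, 577–579, 583).  Unit `lit-balaban-r01`
gen 7 (B4 fold owner), HOME `run/shared/lean/pub/lit-balaban/`, SKELETON rows **B4.Eq2.18** ((2.18)–(2.22): the factor
`‖·‖_{∞,p₁}` of (2.21)), **B4.Thm@573** (the graded input `‖K_jG_jh_jg‖_{(0)} ≤ β‖g‖_{(1)}` of the general-`Ω` chain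
`B4Ineq110LpChain.ineq110_value_lp` at the interior cubes), **B4.Lem2.2** ((2.17) «from L^{p₁}(□) with p₁ > d to
L^∞(□)»).  File 1 of the r01 g7 programme (general-`Ω` Theorem (1.10) under `R₀`, end to end).  Imports p35 g6's
`B4Eq220CubeField` (→ `B4CubeFieldHyps22`: `cubeField_hyps`, `cubeField_threshold`, `aSeq_window`, the charge scalings;
→ p35 g5's `B4Eq220FactorField.eq221_psup_box`: the `‖·‖_{∞,p}` factor on a box with explicit contour/field
hypotheses; → `B4Lemma22EtaBox`: `lpW`, `supN_le_lpW_of`; → `B4Lower18Regular.green_box_l2_bound`,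
`B4Lemma22SupStair.stair_lsum_le`).

WHAT IS PRINTED (p. 578, verbatim).  «We apply Lemma 2.2 to the terms of the second sum also, more exactly we apply (2.17)
with 1/p − 1/q = 1/p₁ and we fix n₀ such that p₁ = 2n₀ > d + 1, e.g. n₀ = d. We estimate the second sum by
Σ′_{ω:n>n₀}c₁‖K_{ω₁}G_k(□_{ω₁},Ã_{ω₁})h_{ω₁}‖_{∞,p₁}‖K_{ω₂}G_k(□_{ω₂},Ã_{ω₂})h_{ω₂}‖_{p₁,p₁/2} ⋯ (2.21)»; p. 579:
«Here ‖T‖_{q,p} denotes a norm of an operator T : L^p → L^q»; Lemma 2.2 p. 578: «for 1 ≤ p, q ≤ ∞, satisfying the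
condition 1/p − 1/p₁ ≤ 1/q ≤ 1/p with p₁ > d»; p. 583: «the operators G_k(□), ∂^η_μG_k(□), G_k(□)∂^{η*}_μ are bounded
operators from L^{p₁}(□) with p₁ > d to L^∞(□)»; p. 575: «if □_j is an interior cube of Ω, then … Ã_j = A₀ + θ_jA′».

WHY THIS FILE.  The general-`Ω` chain `B4Ineq110LpChain.ineq110_value_lp` grades its letters through the levels
`‖·‖_∞ = ‖·‖_{(0)}`, `‖·‖_{(i)} = ‖·‖_{p₁/i,η}` (`1 ≤ i ≤ n₀`, `p₁ = 2n₀`); its hypothesis `hgr` at `i = 1` is the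
`L^{p₁} → L^∞` factor of (2.21).  p35's `B4Eq220CubeField` delivers at the cube configurations the `(∞,∞)` factor
(`eq220_cubeField`) and every `(q,p)` factor with `q < ∞` (`eq221_cubeField`); the edge `q = ∞`, `p ≥ p₁` was left at
the box level with explicit hypotheses (`B4Eq220FactorField.eq221_psup_box`).  This file carries it through the same
three reductions as its siblings: staircase contours (§1), [B4]'s own `h_j` (§2), the cube configuration of a
(1.7)-regular field with only «0 < e ≤ e₁» (§3).

WHAT THIS MODULE PROVES (all in full; `d + 1` lattice dimensions, box `□ = Π_μ[0,nM_μ)`, `n = L^k`, `L = ℓ + 1 ≥ 2`).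
* §1 `eq221_psup_stair` — (2.21), factor `‖·‖_{∞,p}`, `p ≥ p₁ > d + 1`, at `Ã = A₀ + A′` on a box WITH THE STAIRCASE
  CONTOURS: invertibility of `H_k(□,Ã)` from `green_box_l2_bound`, contour sums `τ = (d+1)θ` from `stair_lsum_le`,
  ends from `stairContour_end`; `‖K_hG_k(□,Ã)(hΦ)‖_∞ ≤ (2(d+1)(1+ℓθ)δ₁ + δ₂ + a_kδ₃)·2C·vol^{−1/p}‖Φ‖_p`.
* §2 `eq221_hBox_psup_stair` — the same for [B4]'s own `h_j` (`B4Eq220PartitionSizes.hBox`, sizes `hsize_hBox`), in the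
  printed `η`-weighted source norm: `‖K_{h_j}G_k(□,Ã)(h_jΦ)‖_∞ ≤ (2(d+1)(1+ℓθ) + 1 + a_k)·s·K⁻¹·2C·‖Φ‖_{p,η}`,
  `s = (d+1)(D1(h) + D2(h))` — «c₂O(1)M⁻¹».
* §3 **`eq221_psup_cubeField`** — AT THE CUBE CONFIGURATION `Ã_j` OF A (1.7)-REGULAR FIELD, quantifier discipline of
  `B4Eq220CubeField` (the constant `C` first; for `(c, β, S, K)` a threshold `e₁`; then the instance):
  `‖K_{h_j}G_k(□,Ã_j)(h_jΦ)‖_∞ ≤ (C/K)‖Φ‖_{p,η}` for every `p ≥ p₁`, at coupling `e/n`, `0 < e ≤ e₁`.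
HONEST SCOPE.  Interior cubes (box carriers, staircase contours) exactly as in `B4Eq220CubeField`; the identification
with the region's Neumann-cut cube operators is made in the sequel files of the r01 g7 programme, not here; `C` depends
on `(d, N, ℓ₁, L, a₋, a₊, m²₊, p₁)`, `e₁` in addition on `(c, β, S, K)`.  Theorems only (two private helpers copied from
`B4Eq220FactorField`, where they are private); no `def`, no `Prop` fact, no `sorry`; axioms standard.

v1.1 (unit `lit-balaban-r01` gen 21, 2026-08-22; DOCSTRING-ONLY, every declaration byte-identical): locator of (1.7) in
the docstring of `eq221_psup_cubeField` «(1.7) p. 573» → «(1.7) p. 572» — (1.7) is the last display of p. 572 [PDF 2],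
its sentence ending «and c is some universal constant» on p. 573 l. 1 (class P48-005 / P69-003 of the summit-lit1
CITELOC register, found by an own-stem locator audit against the held text layer); the page list of the citation
header completed accordingly (pp. 572–573 for (1.2)/(1.7) and the Theorem, p. 583 for the quoted Lemma 2.2 sentence).
-/

namespace Literature.MathematicalPhysics.QuantumFieldTheory.Balaban1983to89.B4Eq221PsupCubeField

open Finset Matrix
open Literature.MathematicalPhysics.QuantumFieldTheory.Balaban1983to89.B4GaugeCovariance
open Literature.MathematicalPhysics.QuantumFieldTheory.Balaban1983to89.B4Commutators25to211 (mulH)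
open Literature.MathematicalPhysics.QuantumFieldTheory.Balaban1983to89.B4Reflection242 (boxDom nbrs)
open Literature.MathematicalPhysics.QuantumFieldTheory.Balaban1983to89.B4Lower18Regular (e1 baseEmb stairContour lsum
  stairContour_end green_box_l2_bound)
open Literature.MathematicalPhysics.QuantumFieldTheory.Balaban1983to89.B4Lemma22Reduce231 (supN supN_nonneg)
open Literature.MathematicalPhysics.QuantumFieldTheory.Balaban1983to89.B4Lemma22ReduceZero (Box opA greenA)
open Literature.MathematicalPhysics.QuantumFieldTheory.Balaban1983to89.B4Lemma22LpStair (lpM lpM_nonneg)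
open Literature.MathematicalPhysics.QuantumFieldTheory.Balaban1983to89.B4Lemma22PertVSup (constBond_antisymm)
open Literature.MathematicalPhysics.QuantumFieldTheory.Balaban1983to89.B4Lemma22SupStair (stair_lsum_le)
open Literature.MathematicalPhysics.QuantumFieldTheory.Balaban1983to89.B4Lemma22EtaBox (vol vol_pos lpW lpW_nonneg
  supN_le_lpW_of)
open Literature.MathematicalPhysics.QuantumFieldTheory.Balaban1983to89.B4Eq220CommutatorZeroBox (HSize)
open Literature.MathematicalPhysics.QuantumFieldTheory.Balaban1983to89.B4PartitionUnity22 (hprof thetaProf D1 D2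
  D1_nonneg D2_nonneg contDiff_hprof hasCompactSupport_hprof contDiff_thetaProf hasCompactSupport_thetaProf)
open Literature.MathematicalPhysics.QuantumFieldTheory.Balaban1983to89.B4Eq220PartitionSizes (hBox hsize_hBox)
open Literature.MathematicalPhysics.QuantumFieldTheory.Balaban1983to89.B4Eq220CommutatorField (kOp sizes_Minv_field)
open Literature.MathematicalPhysics.QuantumFieldTheory.Balaban1983to89.B4Eq220FactorField (eq221_psup_box)
open Literature.MathematicalPhysics.QuantumFieldTheory.Balaban1983to89.B4CubeFields22 (cubeField)
open Literature.MathematicalPhysics.QuantumFieldTheory.Balaban1983to89.B4CubeFieldHyps22 (kOp_smul greenA_smul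
  smul_cubeField cubeField_hyps cubeField_threshold aSeq_window)

noncomputable section

variable {ι : Type} [Fintype ι] [DecidableEq ι]

/-! ## §0. Plumbing (copies of the private helpers of `B4Eq220FactorField`) -/

/-- `Ã = A₀ + A′` is antisymmetric when `A′` is («A_b̄ = −A_b»). [cite: Balaban1983RegularityDecay, p. 572 (1.2)] -/
private theorem field_antisymm {d : ℕ} {X : Type*} (A₀ : Fin (d + 1) → ℝ) (pos : X → Fin (d + 1) → ℤ)
    {A' : X → X → ℝ} (hanti' : ∀ x y, A' y x = -A' x y) (x y : X) :
    (constBond A₀ pos + A') y x = -(constBond A₀ pos + A') x y := by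
  simp only [Pi.add_apply, constBond_antisymm A₀ pos x y, hanti' x y, neg_add]

/-- `a_k > 0` on the window («a_k ↘ a(1 − L^{−2})»). [cite: Balaban1982Higgs1, (2.15) p.609] -/
private theorem aSeq_pos' {ℓ k : ℕ} (hℓ : 1 ≤ ℓ) (hk : 1 ≤ k) {amin a : ℝ} (ha : 0 < amin) (e1' : amin ≤ a) :
    0 < B1.aSeq a ((ℓ : ℝ) + 1) k := by
  have hL : (1 : ℝ) < (ℓ : ℝ) + 1 := by
    have : (1 : ℝ) ≤ ℓ := by exact_mod_cast hℓ
    linarith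
  exact B1.aSeq_pos (lt_of_lt_of_le ha e1') hL hk

/-! ## §1. Staircase contours: the operator-side hypotheses of `eq221_psup_box` discharged -/

section Stair

/-- **(2.21), THE FACTOR `‖·‖_{∞,p}` (`p ≥ p₁ > d + 1`), AT A REGULAR FIELD ON A BOX WITH THE STAIRCASE CONTOURS —
everything discharged but the printed smallness of the field** (invertibility of `H_k(□,Ã)` from
`B4Lower18Regular.green_box_l2_bound` under `ℓ²θ²(d+1)(1 + a_k(d+1)) ≤ min(2,a_k)/4`, contour ends from
`stairContour_end`, `τ = (d+1)θ` from `B4Lemma22SupStair.stair_lsum_le`): for `A′` antisymmetric, of bond size `θ/n`,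
bond derivative `θ′/n²`, vanishing on the bonds touching the faces, for every `h` of sizes `(δ₁, δ₂, δ₃)` and every
`Φ`: `‖K_hG_k(□,Ã)(hΦ)‖_∞ ≤ (2(d+1)(1+ℓθ)δ₁ + δ₂ + a_kδ₃)·2C·vol^{−1/p}·‖Φ‖_p`, uniformly in `k` (`η = L^{-k}`).
[cite: Balaban1983RegularityDecay, (2.21) p. 578 «‖K_{ω₁}G_k(□_{ω₁},Ã_{ω₁})h_{ω₁}‖_{∞,p₁}» with (2.10) p. 576 and Lemma 2.2 (2.17) p. 578, p. 583] -/
theorem eq221_psup_stair (F : OrthFlow ι) {ℓ₁ : ℝ} (hℓ₁ : 0 ≤ ℓ₁)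
    (hLip : ∀ t (v : ι → ℝ), ((F.U t - 1) *ᵥ v) ⬝ᵥ ((F.U t - 1) *ᵥ v) ≤ (ℓ₁ * t) ^ 2 * (v ⬝ᵥ v))
    (κ : ℝ) (d ℓ : ℕ) (hℓ : 1 ≤ ℓ) (amin aplus m2plus : ℝ) (ha : 0 < amin) {p₁ : ℝ} (hp₁ : (d : ℝ) + 1 < p₁) :
    ∃ c : ℝ, 0 < c ∧ ∃ C : ℝ, 0 < C ∧ ∀ (k : ℕ), 1 ≤ k → ∀ (hn : 1 ≤ (ℓ + 1) ^ k) (a m2 : ℝ),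
      amin ≤ a → a ≤ aplus → 0 ≤ m2 → m2 ≤ m2plus →
      ∀ (M : Fin (d + 1) → ℕ), (∀ i, 1 ≤ M i) →
      ∀ (A₀ : Fin (d + 1) → ℝ) (A' : ↥(Box d ℓ k M) → ↥(Box d ℓ k M) → ℝ) (θ θ' : ℝ),
        (∀ x y, A' y x = -A' x y) →
        0 ≤ θ → (∀ x y : ↥(Box d ℓ k M), y.1 ∈ nbrs x.1 → |κ * A' x y| ≤ θ / ((ℓ + 1) ^ k : ℕ)) →
        0 ≤ θ' → (∀ (x z y : ↥(Box d ℓ k M)) (μ : Fin (d + 1)), z.1 = x.1 + e1 μ → y.1 = z.1 + e1 μ →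
          |κ * (A' y z - A' z x)| ≤ θ' / (((ℓ + 1) ^ k : ℕ) : ℝ) ^ 2 ∧
          |κ * (A' x z - A' z y)| ≤ θ' / (((ℓ + 1) ^ k : ℕ) : ℝ) ^ 2) →
        (∀ (x y : ↥(Box d ℓ k M)) (μ : Fin (d + 1)), y.1 = x.1 + e1 μ →
          (x.1 - e1 μ ∉ Box d ℓ k M ∨ y.1 + e1 μ ∉ Box d ℓ k M) → A' x y = 0 ∧ A' y x = 0) →
        ℓ₁ ^ 2 * θ ^ 2 * ((d : ℝ) + 1) * (1 + B1.aSeq a ((ℓ : ℝ) + 1) k * ((d : ℝ) + 1))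
          ≤ min 2 (B1.aSeq a ((ℓ : ℝ) + 1) k) / 4 →
        ((d : ℝ) + 2) * c * (((d : ℝ) + 1) * ℓ₁ * (θ + θ') + ((d : ℝ) + 1) * ℓ₁ * θ
          + ((d : ℝ) + 1) * ℓ₁ ^ 2 * θ ^ 2
          + B1.aSeq a ((ℓ : ℝ) + 1) k * (ℓ₁ * (((d : ℝ) + 1) * θ) * (2 + ℓ₁ * (((d : ℝ) + 1) * θ)))) ≤ 1 / 2 →
        ∀ (p : ℝ), p₁ ≤ p →
        ∀ (δ₁ δ₂ δ₃ : ℝ) (h : ↥(Box d ℓ k M) → ℝ), HSize ((ℓ + 1) ^ k) M h δ₁ δ₂ δ₃ →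
        ∀ Φ : ↥(Box d ℓ k M) × ι → ℝ,
          supN (kOp F κ ((ℓ + 1) ^ k) (B1.aSeq a ((ℓ : ℝ) + 1) k) m2 M (baseEmb hn M) (stairContour hn M)
                (constBond A₀ Subtype.val + A') h
              *ᵥ (greenA d F κ ℓ k a m2 M (baseEmb hn M) (stairContour hn M) (constBond A₀ Subtype.val + A')
                  *ᵥ (mulH (ι := ι) h *ᵥ Φ)))
            ≤ (2 * ((d : ℝ) + 1) * (1 + ℓ₁ * θ) * δ₁ + δ₂ + B1.aSeq a ((ℓ : ℝ) + 1) k * δ₃)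
              * (2 * (C * (vol d ℓ k ^ p⁻¹)⁻¹)) * lpM p Φ := by
  obtain ⟨c, hc, C, hC, hL⟩ := eq221_psup_box F hℓ₁ hLip κ d ℓ hℓ amin aplus m2plus ha hp₁
  refine ⟨c, hc, C, hC, ?_⟩
  intro k hk hn a m2 e1' e2 e3 e4 M hM A₀ A' θ θ' hanti' hθ hA' hθ' hder hbd hsm2 hsm p hp δ₁ δ₂ δ₃ h hh Φ
  have hak : 0 < B1.aSeq a ((ℓ : ℝ) + 1) k := aSeq_pos' hℓ hk ha e1'
  have hpos : 0 < min 2 (B1.aSeq a ((ℓ : ℝ) + 1) k) / 4 + m2 := by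
    have : 0 < min 2 (B1.aSeq a ((ℓ : ℝ) + 1) k) := lt_min two_pos hak
    linarith
  have hAd : ∀ x y : ↥(Box d ℓ k M), y.1 ∈ nbrs x.1 →
      |κ * ((constBond A₀ Subtype.val + A' : ↥(Box d ℓ k M) → ↥(Box d ℓ k M) → ℝ) x y
        - constBond A₀ Subtype.val x y)| ≤ θ / ((ℓ + 1) ^ k : ℕ) := by
    intro x y hxy
    simpa only [Pi.add_apply, add_sub_cancel_left] using hA' x y hxy
  have hunit := (green_box_l2_bound F hℓ₁ hLip κ hn hak.le hpos M A₀ (A := constBond A₀ Subtype.val + A') hθ hAd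
    hsm2 0).1
  have hτ : ∀ y x, blkWt ((ℓ + 1) ^ k) M (fun i => (ℓ + 1) ^ k * M i) y x ≠ 0 →
      |κ * lsum A' (baseEmb hn M y) (stairContour hn M y x)| ≤ ((d : ℝ) + 1) * θ :=
    fun y x _ => stair_lsum_le κ hn M hθ hA' y x
  have hτ0 : 0 ≤ ((d : ℝ) + 1) * θ := by positivity
  exact hL k hk a m2 e1' e2 e3 e4 M hM (baseEmb hn M) (stairContour hn M) (fun y x hw => stairContour_end hn M y x hw)
    A₀ A' θ θ' (((d : ℝ) + 1) * θ) hanti' hunit hθ hA' hθ' hder hbd hτ0 hτ hsm p hp δ₁ δ₂ δ₃ h hh Φ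

end Stair

/-! ## §2. [B4]'s own partition function `h_j`: «c₂O(1)M⁻¹» in the `η`-weighted source norm -/

section Concrete

/-- **«‖K_jG_k(□_j,Ã_j)h_j‖_{∞,p} ≤ c₂O(1)M⁻¹» FOR [B4]'s OWN `h_j` AT A REGULAR FIELD ON A BOX, THE FACTOR `‖·‖_{∞,p₁}`
OF (2.21) IN THE `η`-WEIGHTED NORM** (staircase contours; box sides multiples of `K ≥ 2`; every `p ≥ p₁ > d + 1`;
`h_j = B4Eq220PartitionSizes.hBox`, sizes `hsize_hBox`):
`‖K_{h_j}G_k(□,Ã)(h_jΦ)‖_∞ ≤ (2(d+1)(1+ℓθ) + 1 + a_k)·s·K⁻¹·2C·‖Φ‖_{p,η}`, `s = (d+1)(D1(h) + D2(h))`, the constant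
independent of `η`.
[cite: Balaban1983RegularityDecay, (2.21) p. 578 «c₂O(1)M⁻¹» with p. 575 (h_j), p. 577 «|∂^ηh_j| ≤ O(M⁻¹), |Δ^ηh_j| ≤ O(M⁻²)», p. 579] -/
theorem eq221_hBox_psup_stair (F : OrthFlow ι) {ℓ₁ : ℝ} (hℓ₁ : 0 ≤ ℓ₁)
    (hLip : ∀ t (v : ι → ℝ), ((F.U t - 1) *ᵥ v) ⬝ᵥ ((F.U t - 1) *ᵥ v) ≤ (ℓ₁ * t) ^ 2 * (v ⬝ᵥ v))
    (κ : ℝ) (d ℓ : ℕ) (hℓ : 1 ≤ ℓ) (amin aplus m2plus : ℝ) (ha : 0 < amin) {p₁ : ℝ} (hp₁ : (d : ℝ) + 1 < p₁) :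
    ∃ c : ℝ, 0 < c ∧ ∃ C : ℝ, 0 < C ∧ ∀ (k : ℕ), 1 ≤ k → ∀ (hn : 1 ≤ (ℓ + 1) ^ k) (a m2 : ℝ),
      amin ≤ a → a ≤ aplus → 0 ≤ m2 → m2 ≤ m2plus →
      ∀ (M : Fin (d + 1) → ℕ), (∀ i, 1 ≤ M i) → ∀ (K : ℕ) (j : Fin (d + 1) → ℤ), 2 ≤ K → (∀ μ, K ∣ M μ) →
      ∀ (A₀ : Fin (d + 1) → ℝ) (A' : ↥(Box d ℓ k M) → ↥(Box d ℓ k M) → ℝ) (θ θ' : ℝ),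
        (∀ x y, A' y x = -A' x y) →
        0 ≤ θ → (∀ x y : ↥(Box d ℓ k M), y.1 ∈ nbrs x.1 → |κ * A' x y| ≤ θ / ((ℓ + 1) ^ k : ℕ)) →
        0 ≤ θ' → (∀ (x z y : ↥(Box d ℓ k M)) (μ : Fin (d + 1)), z.1 = x.1 + e1 μ → y.1 = z.1 + e1 μ →
          |κ * (A' y z - A' z x)| ≤ θ' / (((ℓ + 1) ^ k : ℕ) : ℝ) ^ 2 ∧
          |κ * (A' x z - A' z y)| ≤ θ' / (((ℓ + 1) ^ k : ℕ) : ℝ) ^ 2) →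
        (∀ (x y : ↥(Box d ℓ k M)) (μ : Fin (d + 1)), y.1 = x.1 + e1 μ →
          (x.1 - e1 μ ∉ Box d ℓ k M ∨ y.1 + e1 μ ∉ Box d ℓ k M) → A' x y = 0 ∧ A' y x = 0) →
        ℓ₁ ^ 2 * θ ^ 2 * ((d : ℝ) + 1) * (1 + B1.aSeq a ((ℓ : ℝ) + 1) k * ((d : ℝ) + 1))
          ≤ min 2 (B1.aSeq a ((ℓ : ℝ) + 1) k) / 4 →
        ((d : ℝ) + 2) * c * (((d : ℝ) + 1) * ℓ₁ * (θ + θ') + ((d : ℝ) + 1) * ℓ₁ * θ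
          + ((d : ℝ) + 1) * ℓ₁ ^ 2 * θ ^ 2
          + B1.aSeq a ((ℓ : ℝ) + 1) k * (ℓ₁ * (((d : ℝ) + 1) * θ) * (2 + ℓ₁ * (((d : ℝ) + 1) * θ)))) ≤ 1 / 2 →
        ∀ (p : ℝ), p₁ ≤ p →
        ∀ Φ : ↥(Box d ℓ k M) × ι → ℝ,
          supN (kOp F κ ((ℓ + 1) ^ k) (B1.aSeq a ((ℓ : ℝ) + 1) k) m2 M (baseEmb hn M) (stairContour hn M)
                (constBond A₀ Subtype.val + A') (hBox ((ℓ + 1) ^ k) K M j)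
              *ᵥ (greenA d F κ ℓ k a m2 M (baseEmb hn M) (stairContour hn M) (constBond A₀ Subtype.val + A')
                  *ᵥ (mulH (ι := ι) (hBox ((ℓ + 1) ^ k) K M j) *ᵥ Φ)))
            ≤ (2 * ((d : ℝ) + 1) * (1 + ℓ₁ * θ) + 1 + B1.aSeq a ((ℓ : ℝ) + 1) k)
              * (((d : ℝ) + 1) * (D1 hprof + D2 hprof)) / K * (2 * C) * lpW d ℓ k p Φ := by
  obtain ⟨c, hc, C, hC, hL⟩ := eq221_psup_stair F hℓ₁ hLip κ d ℓ hℓ amin aplus m2plus ha hp₁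
  refine ⟨c, hc, C, hC, ?_⟩
  intro k hk hn a m2 e1' e2 e3 e4 M hM K j hK2 hKM A₀ A' θ θ' hanti' hθ hA' hθ' hder hbd hsm2 hsm p hp Φ
  have hK1 : 1 ≤ K := le_trans (by norm_num) hK2
  have hn2 : 2 ≤ (ℓ + 1) ^ k := by
    calc 2 ≤ ℓ + 1 := by omega
      _ = (ℓ + 1) ^ 1 := (pow_one _).symm
      _ ≤ (ℓ + 1) ^ k := Nat.pow_le_pow_right (Nat.succ_pos ℓ) hk
  have hnK : 3 ≤ (ℓ + 1) ^ k * K := by nlinarith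
  have hs : 0 ≤ ((d : ℝ) + 1) * (D1 hprof + D2 hprof) := by
    have := D1_nonneg contDiff_hprof hasCompactSupport_hprof
    have := D2_nonneg contDiff_hprof hasCompactSupport_hprof
    positivity
  have hKr : (1 : ℝ) ≤ K := by exact_mod_cast hK1
  have h0 := hL k hk hn a m2 e1' e2 e3 e4 M hM A₀ A' θ θ' hanti' hθ hA' hθ' hder hbd hsm2 hsm p hp _ _ _ _
    (hsize_hBox hn hK1 hnK hKM j) Φ
  have har := sizes_Minv_field d (1 + ℓ₁ * θ) (B1.aSeq a ((ℓ : ℝ) + 1) k) hKr hs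
  have hV : 0 ≤ (vol d ℓ k ^ p⁻¹)⁻¹ := inv_nonneg.2 (Real.rpow_nonneg (vol_pos d ℓ k).le _)
  have hC0 : 0 ≤ 2 * (C * (vol d ℓ k ^ p⁻¹)⁻¹) := mul_nonneg zero_le_two (mul_nonneg hC.le hV)
  have h1 := mul_le_mul_of_nonneg_right (mul_le_mul_of_nonneg_right har hC0) (lpM_nonneg p Φ)
  refine supN_le_lpW_of (d := d) (ℓ := ℓ) (k := k) ?_
  refine (h0.trans h1).trans (le_of_eq ?_)
  ring

end Concrete

/-! ## §3. The pay-off at the cube configuration `Ã_j` of a (1.7)-regular field -/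

section Payoff

variable {d : ℕ}

/-- **(2.21), THE FACTOR «‖K_{ω₁}G_k(□_{ω₁},Ã_{ω₁})h_{ω₁}‖_{∞,p₁}», AT THE INTERIOR CUBES FOR A (1.7)-REGULAR FIELD,
`η`-UNIFORMLY, WITH ONLY «e SUFFICIENTLY SMALL»**: there is `C > 0` (from Lemma 2.2 at charge `1`: `d`, `N`, the flow,
`L`, the windows, `p₁ > d + 1`) such that for every regularity pair `(c, β)`, `β > 0`, every side bound `S` and
large-cube size `K ≥ 2` there is `e₁ > 0` with: for every mesh `n = L^k` (`nK ≥ 16`), every `a, m²` of the windows,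
every box `□ = Π_μ[0, nM_μ)` (`M_μ ≤ S`, `K ∣ M_μ`), every label `j` whose cube sits in `□` (`j_μ ≥ 1`,
`K(j_μ + 1) ≤ M_μ`), EVERY vector field `A` regular on `□` in the sense (1.7), every charge `0 < e ≤ e₁` and every
`p ≥ p₁`:  `‖K_{h_j}G_k(□,Ã_j)(h_jΦ)‖_∞ ≤ (C/K)‖Φ‖_{p,η}` at coupling `e/n` — the graded input
`‖K_jG_jh_jg‖_{(0)} ≤ β‖g‖_{(1)}` of `B4Ineq110LpChain.ineq110_value_lp` at the interior cubes, reduced to (1.7).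
[cite: Balaban1983RegularityDecay, (2.21) p. 578 «‖·‖_{∞,p₁}», «c₂O(1)M⁻¹» with §2 p. 575 (Ã_j), (1.7) p. 572 and Lemma 2.2 p. 583 «from L^{p₁}(□) … to L^∞(□)»] -/
theorem eq221_psup_cubeField (F : OrthFlow ι) {ℓ₁ : ℝ} (hℓ₁ : 0 ≤ ℓ₁)
    (hLip : ∀ t (v : ι → ℝ), ((F.U t - 1) *ᵥ v) ⬝ᵥ ((F.U t - 1) *ᵥ v) ≤ (ℓ₁ * t) ^ 2 * (v ⬝ᵥ v))
    (d ℓ : ℕ) (hℓ : 1 ≤ ℓ) (amin aplus m2plus : ℝ) (ha : 0 < amin) {p₁ : ℝ} (hp₁ : (d : ℝ) + 1 < p₁) :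
    ∃ C : ℝ, 0 < C ∧ ∀ (creg β : ℝ), 0 ≤ creg → 0 < β → ∀ (S K : ℕ), 2 ≤ K →
      ∃ e₁ : ℝ, 0 < e₁ ∧ ∀ (k : ℕ), 1 ≤ k → ∀ (hn : 1 ≤ (ℓ + 1) ^ k), 16 ≤ (ℓ + 1) ^ k * K →
      ∀ (a m2 : ℝ), amin ≤ a → a ≤ aplus → 0 ≤ m2 → m2 ≤ m2plus →
      ∀ (M : Fin (d + 1) → ℕ), (∀ i, 1 ≤ M i) → (∀ i, M i ≤ S) → (∀ μ, K ∣ M μ) →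
      ∀ (j : Fin (d + 1) → ℤ), (∀ μ, 1 ≤ j μ) → (∀ μ, (K : ℤ) * (j μ + 1) ≤ M μ) →
      ∀ (Ac : (Fin (d + 1) → ℤ) → Fin (d + 1) → ℝ) (e : ℝ), 0 < e → e ≤ e₁ →
        (∀ x ∈ Box d ℓ k M, ∀ μ ν : Fin (d + 1),
          |Ac (x + e1 μ) ν - Ac x ν| ≤ creg * e ^ (β - 1) / ((ℓ + 1) ^ k : ℕ)) →
      ∀ (p : ℝ), p₁ ≤ p →
      ∀ Φ : ↥(Box d ℓ k M) × ι → ℝ,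
        supN (kOp F (e / ((ℓ + 1) ^ k : ℕ)) ((ℓ + 1) ^ k) (B1.aSeq a ((ℓ : ℝ) + 1) k) m2 M (baseEmb hn M)
              (stairContour hn M) (cubeField (Box d ℓ k M) ((ℓ + 1) ^ k) K j (Ac 0) Ac) (hBox ((ℓ + 1) ^ k) K M j)
            *ᵥ (greenA d F (e / ((ℓ + 1) ^ k : ℕ)) ℓ k a m2 M (baseEmb hn M) (stairContour hn M)
                (cubeField (Box d ℓ k M) ((ℓ + 1) ^ k) K j (Ac 0) Ac)
                *ᵥ (mulH (ι := ι) (hBox ((ℓ + 1) ^ k) K M j) *ᵥ Φ)))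
          ≤ C / K * lpW d ℓ k p Φ := by
  obtain ⟨c, hc, C', hC', hL⟩ := eq221_hBox_psup_stair F hℓ₁ hLip 1 d ℓ hℓ amin aplus m2plus ha hp₁
  have hs : 0 ≤ ((d : ℝ) + 1) * (D1 hprof + D2 hprof) := by
    have := D1_nonneg contDiff_hprof hasCompactSupport_hprof
    have := D2_nonneg contDiff_hprof hasCompactSupport_hprof
    positivity
  by_cases hapl : aplus < amin
  · -- empty `a`-window: the statement is vacuous
    refine ⟨1, one_pos, fun creg β _ _ S K _ => ⟨1, one_pos, ?_⟩⟩
    intro k hk hn hnK a m2 e1' e2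
    exact absurd (e1'.trans e2) (not_le.2 hapl)
  rw [not_lt] at hapl
  have hapl0 : 0 ≤ aplus := ha.le.trans hapl
  set C : ℝ := (2 * ((d : ℝ) + 1) * (1 + ℓ₁) + 1 + aplus) * (((d : ℝ) + 1) * (D1 hprof + D2 hprof) + 1)
    * (2 * C') with hC_def
  have hC0 : 0 < C := by rw [hC_def]; positivity
  refine ⟨C, hC0, fun creg β hcreg hβ S K hK2 => ?_⟩
  obtain ⟨e₁, he₁, hth⟩ := cubeField_threshold d (c := c) (aplus := aplus) hℓ₁ hc.le ha hcreg hβ S K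
  refine ⟨e₁, he₁, ?_⟩
  intro k hk hn hnK a m2 e1' e2 e3 e4 M hM hS hKM j hjlo hjhi Ac e he hle h17 p hp Φ
  have hK1 : 1 ≤ K := le_trans (by norm_num) hK2
  obtain ⟨hak1, hak2⟩ := aSeq_window hℓ hk ha e1' e2
  obtain ⟨hθ1, hsm2, hsm⟩ := hth e he hle _ hak1 hak2
  obtain ⟨hanti', hA', hder, hbd⟩ := cubeField_hyps (d := d) hn hS hK1 hnK hjlo hjhi hcreg he h17 (β := β)
  have hθ0 : 0 ≤ ((d : ℝ) + 1) * S * creg * e ^ β := by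
    have := (Real.rpow_pos_of_pos he β).le; positivity
  have hθ'0 : 0 ≤ creg * e ^ β * (1 + D1 thetaProf * (((d : ℝ) + 1) * S) / K) := by
    have := (Real.rpow_pos_of_pos he β).le
    have := D1_nonneg contDiff_thetaProf hasCompactSupport_thetaProf
    positivity
  have main := hL k hk hn a m2 e1' e2 e3 e4 M hM K j hK2 hKM (fun μ => e / ((ℓ + 1) ^ k : ℕ) * Ac 0 μ) _
    _ _ hanti' hθ0 hA' hθ'0 hder hbd hsm2 hsm p hp Φ
  rw [kOp_smul, greenA_smul, smul_cubeField]
  refine main.trans (mul_le_mul_of_nonneg_right ?_ (lpW_nonneg d ℓ k p Φ))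
  -- the constant: `(2(d+1)(1+ℓ₁θ) + 1 + a_k)·s/K·2C' ≤ C/K`
  have hKr : (0 : ℝ) < K := by exact_mod_cast hK1
  have h1 : 2 * ((d : ℝ) + 1) * (1 + ℓ₁ * (((d : ℝ) + 1) * S * creg * e ^ β)) + 1 + B1.aSeq a ((ℓ : ℝ) + 1) k
      ≤ 2 * ((d : ℝ) + 1) * (1 + ℓ₁) + 1 + aplus := by
    have : ℓ₁ * (((d : ℝ) + 1) * S * creg * e ^ β) ≤ ℓ₁ * 1 := mul_le_mul_of_nonneg_left hθ1 hℓ₁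
    nlinarith
  have h2 : ((d : ℝ) + 1) * (D1 hprof + D2 hprof) ≤ ((d : ℝ) + 1) * (D1 hprof + D2 hprof) + 1 := by linarith
  rw [hC_def, div_eq_mul_inv, div_eq_mul_inv]
  have hpos1 : 0 ≤ 2 * ((d : ℝ) + 1) * (1 + ℓ₁ * (((d : ℝ) + 1) * S * creg * e ^ β)) + 1
      + B1.aSeq a ((ℓ : ℝ) + 1) k := by
    have : 0 ≤ B1.aSeq a ((ℓ : ℝ) + 1) k := by linarith
    positivity
  calc (2 * ((d : ℝ) + 1) * (1 + ℓ₁ * (((d : ℝ) + 1) * S * creg * e ^ β)) + 1 + B1.aSeq a ((ℓ : ℝ) + 1) k)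
        * (((d : ℝ) + 1) * (D1 hprof + D2 hprof)) * (K : ℝ)⁻¹ * (2 * C')
      = ((2 * ((d : ℝ) + 1) * (1 + ℓ₁ * (((d : ℝ) + 1) * S * creg * e ^ β)) + 1 + B1.aSeq a ((ℓ : ℝ) + 1) k)
        * (((d : ℝ) + 1) * (D1 hprof + D2 hprof)) * (2 * C')) * (K : ℝ)⁻¹ := by ring
    _ ≤ ((2 * ((d : ℝ) + 1) * (1 + ℓ₁) + 1 + aplus) * (((d : ℝ) + 1) * (D1 hprof + D2 hprof) + 1)
        * (2 * C')) * (K : ℝ)⁻¹ := by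
        refine mul_le_mul_of_nonneg_right ?_ (inv_nonneg.2 hKr.le)
        exact mul_le_mul_of_nonneg_right (mul_le_mul h1 h2 hs (by positivity)) (by positivity)

/-- **THE STANDARD INTERIOR CUBE**: (2.21), factor `‖·‖_{∞,p}`, on the print's cube itself — side `2K` (`M_μ = 2K`),
label at the centre (`j_μ = 1`), every (1.7)-regular `A` on it, `0 < e ≤ e₁(c, β, K)`, every `p ≥ p₁`: the
hypotheses of `eq221_psup_cubeField` are met (as `B4Eq220CubeField.eq220_cubeField_std` for the sup factor).
[cite: Balaban1983RegularityDecay, (2.21) p. 578 with §2 p. 575 «□_j is a cube of the size 2M and with center in Mj»] -/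
theorem eq221_psup_cubeField_std (F : OrthFlow ι) {ℓ₁ : ℝ} (hℓ₁ : 0 ≤ ℓ₁)
    (hLip : ∀ t (v : ι → ℝ), ((F.U t - 1) *ᵥ v) ⬝ᵥ ((F.U t - 1) *ᵥ v) ≤ (ℓ₁ * t) ^ 2 * (v ⬝ᵥ v))
    (d ℓ : ℕ) (hℓ : 1 ≤ ℓ) (amin aplus m2plus : ℝ) (ha : 0 < amin) {p₁ : ℝ} (hp₁ : (d : ℝ) + 1 < p₁) :
    ∃ C : ℝ, 0 < C ∧ ∀ (creg β : ℝ), 0 ≤ creg → 0 < β → ∀ (K : ℕ), 2 ≤ K →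
      ∃ e₁ : ℝ, 0 < e₁ ∧ ∀ (k : ℕ), 1 ≤ k → ∀ (hn : 1 ≤ (ℓ + 1) ^ k), 16 ≤ (ℓ + 1) ^ k * K →
      ∀ (a m2 : ℝ), amin ≤ a → a ≤ aplus → 0 ≤ m2 → m2 ≤ m2plus →
      ∀ (Ac : (Fin (d + 1) → ℤ) → Fin (d + 1) → ℝ) (e : ℝ), 0 < e → e ≤ e₁ →
        (∀ x ∈ Box d ℓ k (fun _ => 2 * K), ∀ μ ν : Fin (d + 1),
          |Ac (x + e1 μ) ν - Ac x ν| ≤ creg * e ^ (β - 1) / ((ℓ + 1) ^ k : ℕ)) →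
      ∀ (p : ℝ), p₁ ≤ p →
      ∀ Φ : ↥(Box d ℓ k (fun _ => 2 * K)) × ι → ℝ,
        supN (kOp F (e / ((ℓ + 1) ^ k : ℕ)) ((ℓ + 1) ^ k) (B1.aSeq a ((ℓ : ℝ) + 1) k) m2 (fun _ => 2 * K)
              (baseEmb hn _) (stairContour hn _)
              (cubeField (Box d ℓ k (fun _ => 2 * K)) ((ℓ + 1) ^ k) K (fun _ => 1) (Ac 0) Ac)
              (hBox ((ℓ + 1) ^ k) K (fun _ => 2 * K) (fun _ => 1))
            *ᵥ (greenA d F (e / ((ℓ + 1) ^ k : ℕ)) ℓ k a m2 (fun _ => 2 * K) (baseEmb hn _) (stairContour hn _)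
                (cubeField (Box d ℓ k (fun _ => 2 * K)) ((ℓ + 1) ^ k) K (fun _ => 1) (Ac 0) Ac)
                *ᵥ (mulH (ι := ι) (hBox ((ℓ + 1) ^ k) K (fun _ => 2 * K) (fun _ => 1)) *ᵥ Φ)))
          ≤ C / K * lpW d ℓ k p Φ := by
  obtain ⟨C, hC, hL⟩ := eq221_psup_cubeField F hℓ₁ hLip d ℓ hℓ amin aplus m2plus ha hp₁
  refine ⟨C, hC, fun creg β hcreg hβ K hK2 => ?_⟩
  obtain ⟨e₁, he₁, h⟩ := hL creg β hcreg hβ (2 * K) K hK2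
  refine ⟨e₁, he₁, ?_⟩
  intro k hk hn hnK a m2 e1' e2 e3 e4 Ac e he hle h17 p hp Φ
  have hK1 : 1 ≤ K := le_trans (by norm_num) hK2
  exact h k hk hn hnK a m2 e1' e2 e3 e4 (fun _ => 2 * K) (fun _ => by omega) (fun _ => le_rfl)
    (fun _ => Dvd.intro_left 2 rfl) (fun _ => 1) (fun _ => le_rfl) (fun _ => by push_cast; omega) Ac e he hle h17 p hp Φ

end Payoff

end

end Literature.MathematicalPhysics.QuantumFieldTheory.Balaban1983to89.B4Eq221PsupCubeField
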